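import Literature.Geometry.Kaehler.ComplexTorusPrimitiveHodgeRankBounds
import Literature.Geometry.Kaehler.ComplexTorusIntegralHodgeClassesRank
import HarnessLib

/-!
# The rational Lefschetz decomposition of the Hodge classes, counted: `dim_ℚ Bᵖ(X) = Σ_{i ≤ min(p, g−p)} dim_ℚ Bⁱ(X)_prim`,
# `Bⁱ(X)_prim = Bⁱ(X) ∩ P^{2i}`, for every polarised abelian variety

Layer `Literature/Geometry/Kaehler`, namespace `Literature.Geometry.Kaehler.ComplexTorus`; lane `lit-hodgefound`
(Track 2 foundations library), seat p09, generation 46, row g46-#5. THEOREMS ONLY (0 definitions); no named fact,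
net debt 0. The tree's currency for Hodge classes is the `ℚ`-vector space `Bᵖ(X) = hodgeClasses Φ p = H^{2p}(X, ℚ) ∩ H^{p,p}` and its
dimension `finrank ℚ (hodgeClasses Φ p)` (products, exotic ranks, analytic classes, CM tori …). This file states the rank identity of
g46-#1 (`ComplexTorusIntegralHodgeLatticeSignatureClosedForm`: `rk Hdgᵖ(X, ℤ) = Σ_{i ≤ p} rk (Hdgⁱ(X, ℤ) ∩ P^{2i})`) in that currency, through the
tree's `rk_ℤ Hdgᵖ(X, ℤ) = dim_ℚ Bᵖ(X)` (`finrank_integralHodgeClassesIn_eq_finrank_hodgeClassesIn`) and g46-#4's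
`rk (Hdgᵖ(X, ℤ) ∩ P^{2p}) = dim_ℚ (Bᵖ(X) ∩ P^{2p})`: the Lefschetz decomposition of the Hodge classes
`Bᵖ(X) = ⊕_{i ≤ p} L^{p−i} Bⁱ(X)_prim` (Lange §7.3.2 (3), Voisin Rem. 6.27: `L` has bidegree `(1,1)` and the primitive components of a Hodge class
are Hodge classes), COUNTED, below the middle; above the middle through hard Lefschetz (`dim Bᵖ = dim B^{g−p}`, Lange §7.3.2 (1), the tree's
`IsRiemannForm.finrank_hodgeClasses_eq_of_add_eq`).

## What is proved

* `IsPolarizationType.finrank_hodgeClassesIn_eq_sum` / `IsPolarizationType.finrank_hodgeClasses_eq_sum`: **`dim_ℚ Bᵖ(X) = Σ_{i ≤ p} dim_ℚ (Bⁱ(X) ∩ P^{2i})`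
  for `2p ≤ g`**; `IsPolarizationType.finrank_hodgeClasses_succ_eq_add`: **`dim Bᵖ⁺¹(X) = dim Bᵖ(X) + dim Bᵖ⁺¹(X)_prim`** (`2p + 2 ≤ g`: `Bᵖ⁺¹ =
  L Bᵖ ⊕ Bᵖ⁺¹_prim`, `L` injective); `IsPolarizationType.finrank_hodgeClasses_eq_sum_of_add_eq`: **`dim_ℚ Bᵖ(X) = Σ_{i ≤ p'} dim_ℚ (Bⁱ(X) ∩ P^{2i})` for
  `p + p' = g`, `p' ≤ p`** (the upper half by hard Lefschetz).
* `IsPolarizationType.finrank_hodgeClasses_inf_primitiveForms_le`: **`dim_ℚ (Bᵖ(X) ∩ P^{2p}) ≤ h^{p,p}_pr = C(g,p)² − C(g,p−1)²`** (`2p ≤ g`);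
  `finrank_hodgeClasses_zero_inf_primitiveForms` (`dim B⁰_prim = 1`) and
  `IsPolarizationType.finrank_hodgeClasses_one_eq_one_add` (**`ρ(X) = dim_ℚ B¹(X) = 1 + dim_ℚ B¹(X)_prim`**, `NS(X)_ℚ = ℚθ ⊕ NS(X)_prim,ℚ`).

## The sources, verbatim (held copies)

* H. Lange, *Abelian Varieties over the Complex Numbers* (Springer 2023; held as `book:lange1992-complex-abelian-varieties`, 2023 numbering),
  §7.3.2 (1)–(3) (hard Lefschetz on the Hodge classes; the Lefschetz decomposition respects the Hodge classes), §7.2.2 (p0331: `B^p(X) ⊗ ℂ`, "Tensoring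
  with `ℂ` …"), §5.4.1 (5.22)–(5.23) and §5.4.2 Thm. 5.4.6 (5.29) (PDF p. 275 ff.), §1.1.3 Cor. 1.1.19 (`Hᵏ(X, ℚ) = Hᵏ(X, ℤ) ⊗ ℚ`).
* C. Voisin, *Hodge Theory and Complex Algebraic Geometry I* (CUP 2002), held `book:voisin2002-hodge-theory-complex-algebraic-geometry-i`, §6.2.3
  Cor. 6.26, Rem. 6.27 (PDF p. 126: the Lefschetz decomposition is compatible with the Hodge decomposition; `L` is a morphism of Hodge structures
  of bidegree `(1,1)`), §7.1.2 (PDF p. 134), §11.3.1.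

## References

* [cite: Lange2023AbelianVarietiesComplex, §7.3.2 (1)–(3); §7.2.2 (PDF p. 331); §5.4.1 (5.22)–(5.23) (PDF p. 275); §5.4.2 Thm. 5.4.6 (5.29); §1.1.3 Cor. 1.1.19]
* [cite: VoisinHodgeI2002, §6.2.3 Cor. 6.26, Rem. 6.27 (PDF p. 126); §7.1.2 (PDF p. 134)]
-/

noncomputable section

-- `Module ℂ` / `SMulZeroClass ℂ` synthesis on `E [⋀^Fin k]→L[ℝ] ℂ` (as in `ComplexTorusLefschetzDecomposition`)
set_option maxSynthPendingDepth 3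

open Module Function
open LinearMap (BilinForm)
open Literature.LinearAlgebra.Alternating
open Literature.Analysis.Complex (IsOfTypeAt typeSubmodule)

namespace Literature.Geometry.Kaehler.ComplexTorus

section RationalRanks

variable {ι : Type*} [Fintype ι] [DecidableEq ι] {E : Type*} [NormedAddCommGroup E] [NormedSpace ℂ E]
  {Φ : (ι → ℝ) ≃L[ℝ] E} {j k p : ℕ} {η : E [⋀^Fin 2]→L[ℝ] ℝ} {d : Fin (j + 2) → ℕ}

omit [DecidableEq ι] in
/-- **`dim_ℚ B^{k,p}(X) = Σ_{i ≤ p} dim_ℚ (Bⁱ(X) ∩ P^{2i})`** (`k = 2p ≤ g`): the dimension of the space of rational Hodge classes of a polarised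
abelian variety is the sum of the dimensions of the primitive rational Hodge classes of codimension `≤ p` — the Lefschetz decomposition
`Bᵖ(X) = ⊕_{i ≤ p} L^{p−i} Bⁱ(X)_prim` counted (g46-#1's integral rank identity, `rk_ℤ = dim_ℚ` on both sides).
[cite: Lange2023AbelianVarietiesComplex, §7.3.2 (3); §7.2.2 (PDF p. 331); §1.1.3 Cor. 1.1.19] [cite: VoisinHodgeI2002, §6.2.3 Rem. 6.27 (PDF p. 126)] -/
theorem IsPolarizationType.finrank_hodgeClassesIn_eq_sum (hd : IsPolarizationType Φ η d) (hη : IsRiemannForm Φ η) (hpk : p + p = k)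
    (hk : k ≤ j + 2) :
    finrank ℚ ↥(hodgeClassesIn Φ k p) =
      ∑ i ∈ Finset.range (p + 1), finrank ℚ ↥(hodgeClassesIn Φ (2 * i) i ⊓ (primitiveForms η (2 * i)).restrictScalars ℚ) := by
  rw [← finrank_integralHodgeClassesIn_eq_finrank_hodgeClassesIn Φ k p, hd.finrank_integralHodgeClassesIn_eq_sum hη hpk hk]
  exact Finset.sum_congr rfl fun i _ ↦ finrank_integralHodgeClassesIn_inf_primitiveForms_eq_finrank_rat Φ (2 * i) i

omit [DecidableEq ι] in
/-- **`dim_ℚ Bᵖ(X) = Σ_{i ≤ p} dim_ℚ Bⁱ(X)_prim`, `Bⁱ(X)_prim = Bⁱ(X) ∩ P^{2i}`, for `2p ≤ g`** (the tree's `hodgeClasses Φ p`).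
[cite: Lange2023AbelianVarietiesComplex, §7.3.2 (3); §7.2.2 (PDF p. 331)] [cite: VoisinHodgeI2002, §6.2.3 Rem. 6.27 (PDF p. 126)] -/
theorem IsPolarizationType.finrank_hodgeClasses_eq_sum (hd : IsPolarizationType Φ η d) (hη : IsRiemannForm Φ η) (hp : 2 * p ≤ j + 2) :
    finrank ℚ ↥(hodgeClasses Φ p) =
      ∑ i ∈ Finset.range (p + 1), finrank ℚ ↥(hodgeClasses Φ i ⊓ (primitiveForms η (2 * i)).restrictScalars ℚ) := by
  unfold hodgeClasses
  exact hd.finrank_hodgeClassesIn_eq_sum hη (by omega) hp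

omit [DecidableEq ι] in
/-- **`dim_ℚ Bᵖ⁺¹(X) = dim_ℚ Bᵖ(X) + dim_ℚ Bᵖ⁺¹(X)_prim`** for `2p + 2 ≤ g`: one Lefschetz step on the rational Hodge classes,
`Bᵖ⁺¹(X) = L Bᵖ(X) ⊕ Bᵖ⁺¹(X)_prim` with `L = · ∧ θ` injective (hard Lefschetz), counted.
[cite: Lange2023AbelianVarietiesComplex, §7.3.2 (1)–(3); §5.4.1 (5.22)–(5.23) (PDF p. 275)] [cite: VoisinHodgeI2002, §6.2.3 Cor. 6.26, Rem. 6.27 (PDF p. 126)] -/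
theorem IsPolarizationType.finrank_hodgeClasses_succ_eq_add (hd : IsPolarizationType Φ η d) (hη : IsRiemannForm Φ η) (hp : 2 * p + 2 ≤ j + 2) :
    finrank ℚ ↥(hodgeClasses Φ (p + 1)) =
      finrank ℚ ↥(hodgeClasses Φ p) + finrank ℚ ↥(hodgeClasses Φ (p + 1) ⊓ (primitiveForms η (2 * (p + 1))).restrictScalars ℚ) := by
  rw [hd.finrank_hodgeClasses_eq_sum hη (by omega : 2 * (p + 1) ≤ j + 2), hd.finrank_hodgeClasses_eq_sum hη (by omega : 2 * p ≤ j + 2),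
    Finset.sum_range_succ _ (p + 1)]

omit [DecidableEq ι] in
/-- **Above the middle, by hard Lefschetz: `dim_ℚ Bᵖ(X) = Σ_{i ≤ p'} dim_ℚ Bⁱ(X)_prim` for `p + p' = g`, `p' ≤ p`** (`dim Bᵖ = dim B^{p'}`, Lange §7.3.2 (1),
and the lower-half count at `p'`). [cite: Lange2023AbelianVarietiesComplex, §7.3.2 (1)–(3)] [cite: VoisinHodgeI2002, §6.2.3 Cor. 6.26, Rem. 6.27 (PDF p. 126)] -/
theorem IsPolarizationType.finrank_hodgeClasses_eq_sum_of_add_eq (hd : IsPolarizationType Φ η d) (hη : IsRiemannForm Φ η) {p' : ℕ}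
    (hpp : p + p' = j + 2) (hle : p' ≤ p) :
    finrank ℚ ↥(hodgeClasses Φ p) =
      ∑ i ∈ Finset.range (p' + 1), finrank ℚ ↥(hodgeClasses Φ i ⊓ (primitiveForms η (2 * i)).restrictScalars ℚ) := by
  haveI : FiniteDimensional ℝ E := Module.Finite.equiv Φ.toLinearEquiv
  haveI : FiniteDimensional ℂ E := Module.Finite.of_restrictScalars_finite ℝ ℂ E
  have hE : finrank ℝ E = Fintype.card ι := by
    rw [← Φ.toLinearEquiv.finrank_eq, Module.finrank_fintype_fun_eq_card]
  have hg : finrank ℂ E = j + 2 := by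
    have h := finrank_real_of_complex E
    rw [hE, hd.card_eq] at h
    omega
  rw [IsRiemannForm.finrank_hodgeClasses_eq_of_add_eq Φ hη (show p + p' = finrank ℂ E by omega)]
  exact hd.finrank_hodgeClasses_eq_sum hη (by omega)

omit [DecidableEq ι] in
/-- **`dim_ℚ (Bᵖ(X) ∩ P^{2p}) ≤ h^{p,p}_pr(g) = C(g,p)² − C(g,p−1)²`** for `2p ≤ g`: the primitive rational Hodge classes span, over `ℂ`, a subspace of
`H^{p,p}_prim` (g46-#4's bound, `rk_ℤ = dim_ℚ`). [cite: Lange2023AbelianVarietiesComplex, §7.2.2 (PDF p. 331); §5.4.2 Thm. 5.4.6 (5.29)] -/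
theorem IsPolarizationType.finrank_hodgeClasses_inf_primitiveForms_le (hd : IsPolarizationType Φ η d) (hη : IsRiemannForm Φ η)
    (hp : 2 * p ≤ j + 2) :
    finrank ℚ ↥(hodgeClasses Φ p ⊓ (primitiveForms η (2 * p)).restrictScalars ℚ) ≤ primitiveHodgeNumber (j + 2) p p := by
  unfold hodgeClasses
  rw [← finrank_integralHodgeClassesIn_inf_primitiveForms_eq_finrank_rat Φ (2 * p) p]
  exact hd.finrank_integralHodgeClassesIn_inf_primitiveForms_le hη (by omega) hp

omit [DecidableEq ι] in
/-- **`dim_ℚ B⁰(X)_prim = 1`**: `B⁰(X) = H⁰(X, ℚ) = ℚ` is primitive. [cite: Lange2023AbelianVarietiesComplex, §5.4.1 (5.22) (PDF p. 275); §1.1.3 Cor. 1.1.19] -/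
theorem finrank_hodgeClasses_zero_inf_primitiveForms (Φ : (ι → ℝ) ≃L[ℝ] E) (η : E [⋀^Fin 2]→L[ℝ] ℝ) :
    finrank ℚ ↥(hodgeClasses Φ 0 ⊓ (primitiveForms η (2 * 0)).restrictScalars ℚ) = 1 := by
  unfold hodgeClasses
  rw [← finrank_integralHodgeClassesIn_inf_primitiveForms_eq_finrank_rat Φ (2 * 0) 0,
    finrank_integralHodgeClassesIn_inf_primitiveForms_congr Φ η (Nat.mul_zero 2) 0, finrank_integralHodgeClassesIn_inf_primitiveForms_zero Φ η]

omit [DecidableEq ι] in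
/-- **`ρ(X) = dim_ℚ B¹(X) = 1 + dim_ℚ B¹(X)_prim`** (`g ≥ 2`): `NS(X)_ℚ = ℚθ ⊕ NS(X)_prim,ℚ` counted (the case `p = 1` of
`finrank_hodgeClasses_eq_sum`; on the lattice: g46-#1's `ρ = 1 + ρ^{(1)}_pr`). [cite: Lange2023AbelianVarietiesComplex, §7.3.2 (3); §5.4.1 (5.22) (PDF p. 275); §1.3.1 Exercise 1.3.4 (10)] -/
theorem IsPolarizationType.finrank_hodgeClasses_one_eq_one_add (hd : IsPolarizationType Φ η d) (hη : IsRiemannForm Φ η) :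
    finrank ℚ ↥(hodgeClasses Φ 1) = 1 + finrank ℚ ↥(hodgeClasses Φ 1 ⊓ (primitiveForms η (2 * 1)).restrictScalars ℚ) := by
  rw [hd.finrank_hodgeClasses_eq_sum hη (by omega : 2 * 1 ≤ j + 2), Finset.sum_range_succ, Finset.sum_range_one,
    finrank_hodgeClasses_zero_inf_primitiveForms Φ η]

end RationalRanks

end Literature.Geometry.Kaehler.ComplexTorus
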